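import Summits.NavierStokesRegularity.NavierStokesRegularity.Theorems.FilamentSkeletonRssCoreLinearInvertibilityParityToolsAux
import Summits.AnomalousDissipation.AnomalousDissipation.Theorems.MarginalStabilityChainStretchedVortexRowsStubCoreInverseIntegrabilityTools

/-!
# Crux `CoreLinearInvertibility` (stmt-NavierStokesRegularity-17973), line `Sketch`:
# stub `stub_parityTools` — the parity split of the linearised core operator

-- attempt log (worker W3):
-- v1: one file (555 lines): reflection lemmas (no differentiability needed: `fderiv_comp_smul`),
--     linearity of `T_{λ,R}` on `C²_c`, even/odd orthogonality in `L²(G_λ⁻¹)`, moments,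
--     `G_λ⁻¹(Tw)² ∈ L¹`; rc 0. v2: split — generic tools moved to `…ParityToolsAux`
--     (sub-stub `stub_parityToolsAux`), this file keeps the Gaussian integrability and the stub.

Theorems-only file (lands `--supports stmt-NavierStokesRegularity-17973`) proving the registered
stub `stub_parityTools` of the skeleton `Cruxes/CoreLinearInvertibility/Lines/Sketch.lean`: for
`T_{λ,R} w = L_λ w − R (v^G·∇w + (K∗w)·∇G)` (`strainedVorticityOperator`, `gaussVortexVelocity`,
`biotSavart2D`, `gaussVortexProfile`, weight `gaussWeightLam`), `λ ∈ [0,1)`, and a `C²` compactly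
supported vorticity `w` with even/odd parts `w_e = (w + w∘(−·))/2`, `w_o = (w − w∘(−·))/2`:
`w_e, w_o ∈ C²_c` with the stated parities, `∫ w_e = ∫ w`, `∫ xᵢ w_o = ∫ xᵢ w`, and the
orthogonal splittings `‖w‖²_{X_λ} = ‖w_e‖² + ‖w_o‖²`, `‖Tw‖²_{X_λ} = ‖Tw_e‖² + ‖Tw_o‖²`
(`X_λ = L²(G_λ⁻¹)`), using the tools of `…ParityToolsAux` (`T` commutes with `x ↦ −x` and is
linear; even/odd splitting for an even weight), continuity lemmas of the proved Theorems file
`Summits.AnomalousDissipation.….StubCoreInverseIntegrabilityTools` (same operator), plus, proved here, **`G_λ⁻¹ (Tw)² ∈ L¹` for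
`C²_c` `w`**: the local part `L_λ w − R v^G·∇w` is continuous with compact support, the
Biot–Savart part `⟪K∗w, ∇G⟫` is bounded by `C‖∇G‖`, and `G_λ⁻¹‖∇G‖² ≤ 4(1−λ)⁻¹ G_{1/2}`
(`t e^{−t/2} ≤ 8 e^{−3t/8}`).
-/

set_option linter.dupNamespace false

noncomputable section

namespace Summit.NavierStokesRegularity.NavierStokesRegularity.Theorems

open MeasureTheory Filter Topology Set
open Literature.Analysis.FluidPDE
open Summit.AnomalousDissipation.AnomalousDissipation.Theorems.MarginalStabilityChainStretchedVortexRows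
open scoped InnerProductSpace Laplacian ContDiff

/-! ### `G_λ⁻¹ (T_{λ,R} w)² ∈ L¹` for `C²` compactly supported `w` -/

/-- `‖∇G(x)‖ = (G(x)/2) ‖x‖`. [folklore] -/
theorem parity_norm_gradient_gaussVortexProfile (x : EuclideanSpace ℝ (Fin 2)) :
    ‖gradient gaussVortexProfile x‖ = gaussVortexProfile x / 2 * ‖x‖ := by
  rw [gradient_gaussVortexProfile, norm_smul, norm_neg,
    Real.norm_of_nonneg (div_nonneg (gaussVortexProfile_pos x).le zero_le_two)]

/-- The Gaussian arithmetic behind `G_λ⁻¹‖∇G‖² ≤ 4(1−λ)⁻¹ G_{1/2}`: with `t = ‖x‖²`,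
`t e^{−t/2} ≤ 8 e^{−(1−λ)t/4} e^{−t/8}` for `λ ≥ 0` (`t ≤ 8e^{t/8}`). [folklore] -/
theorem parity_gauss_arith {lam t : ℝ} (hl0 : 0 ≤ lam) (hl1 : lam < 1) (ht0 : 0 ≤ t) :
    ((1 - lam) / (4 * Real.pi) * Real.exp (-((1 - lam) / 4 * t)))⁻¹ *
        (((4 * Real.pi)⁻¹ * Real.exp (-(t / 4)) / 2) ^ 2 * t) ≤
      4 / (1 - lam) * ((1 - 1 / 2) / (4 * Real.pi) * Real.exp (-((1 - 1 / 2) / 4 * t))) := by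
  have h1l : 0 < 1 - lam := by linarith
  have hpi : 0 < Real.pi := Real.pi_pos
  set a := Real.exp (-((1 - lam) / 4 * t)) with ha
  set b := Real.exp (-(t / 4)) with hb
  set c := Real.exp (-((1 - 1 / 2) / 4 * t)) with hc
  have ha0 : 0 < a := Real.exp_pos _
  have ht8 : t ≤ 8 * Real.exp (t / 8) := by
    have := Real.add_one_le_exp (t / 8)
    linarith [Real.exp_pos (t / 8)]
  have hac : Real.exp (-(3 * t / 8)) ≤ a * c := by
    rw [ha, hc, ← Real.exp_add]
    exact Real.exp_le_exp.2 (by nlinarith [mul_nonneg hl0 ht0])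
  have key : t * b ^ 2 ≤ 8 * (a * c) :=
    calc t * b ^ 2 = t * Real.exp (-(t / 2)) := by
          rw [hb, pow_two, ← Real.exp_add]; ring_nf
      _ ≤ 8 * Real.exp (t / 8) * Real.exp (-(t / 2)) :=
          mul_le_mul_of_nonneg_right ht8 (Real.exp_pos _).le
      _ = 8 * Real.exp (-(3 * t / 8)) := by
          rw [mul_assoc, ← Real.exp_add]; ring_nf
      _ ≤ 8 * (a * c) := by gcongr
  have hL : ((1 - lam) / (4 * Real.pi) * a)⁻¹ * (((4 * Real.pi)⁻¹ * b / 2) ^ 2 * t) =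
      t * b ^ 2 * (16 * Real.pi * (1 - lam) * a)⁻¹ := by
    field_simp
    ring
  have hR : 4 / (1 - lam) * ((1 - 1 / 2) / (4 * Real.pi) * c) =
      8 * (a * c) * (16 * Real.pi * (1 - lam) * a)⁻¹ := by
    field_simp
    ring
  rw [hL, hR]
  exact mul_le_mul_of_nonneg_right key (by positivity)

/-- **`G_λ⁻¹ ‖∇G‖² ≤ 4(1−λ)⁻¹ G_{1/2}`** for `λ ∈ [0,1)`: the Biot–Savart coefficient `∇G` of
`T_{λ,R}` lies in `L²(G_λ⁻¹)` with an integrable Gaussian majorant. [folklore] -/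
theorem parity_inv_weight_mul_norm_gradient_sq_le {lam : ℝ} (hlam : lam ∈ Set.Ico (0 : ℝ) 1)
    (x : EuclideanSpace ℝ (Fin 2)) :
    (gaussWeightLam lam x)⁻¹ * ‖gradient gaussVortexProfile x‖ ^ 2 ≤
      4 / (1 - lam) * gaussWeightLam (1 / 2) x := by
  rw [parity_norm_gradient_gaussVortexProfile, mul_pow]
  exact parity_gauss_arith hlam.1 hlam.2 (sq_nonneg ‖x‖)

/-- The local part `L_λ w − R v^G·∇w` of `T_{λ,R} w` is continuous for `w ∈ C²`. [folklore] -/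
theorem parity_continuous_localPart (lam R : ℝ) {w : EuclideanSpace ℝ (Fin 2) → ℝ}
    (hw : ContDiff ℝ 2 w) :
    Continuous fun x =>
      strainedVorticityOperator lam w x - R * ⟪gaussVortexVelocity x, gradient w x⟫_ℝ := by
  have hg : Continuous (gradient w) := continuous_gradient_of_contDiff (hw.of_le one_le_two)
  exact (continuous_strainedVorticityOperator hw lam).sub
    (continuous_const.mul (continuous_gaussVortexVelocity.inner hg))

/-- The local part of `T_{λ,R} w` vanishes off the support of `w`. [folklore] -/
theorem parity_localPart_eq_zero (lam R : ℝ) {w : EuclideanSpace ℝ (Fin 2) → ℝ}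
    {x : EuclideanSpace ℝ (Fin 2)} (hx : x ∉ tsupport w) :
    strainedVorticityOperator lam w x - R * ⟪gaussVortexVelocity x, gradient w x⟫_ℝ = 0 := by
  simp [strainedVorticityOperator, laplacian_eq_zero_of_notMem_tsupport hx,
    fderiv_of_notMem_tsupport ℝ hx, image_eq_zero_of_notMem_tsupport hx,
    gradient_eq_zero_of_notMem_tsupport hx]

/-- The Biot–Savart coefficient `x ↦ ⟪(K∗w)(x), ∇G(x)⟫` is a.e. strongly measurable for
continuous `w`. [folklore] -/
theorem parity_aestronglyMeasurable_bsPart {w : EuclideanSpace ℝ (Fin 2) → ℝ} (hw : Continuous w) :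
    AEStronglyMeasurable (fun x => ⟪biotSavart2D w x, gradient gaussVortexProfile x⟫_ℝ) volume :=
  ((stronglyMeasurable_biotSavart2D hw.measurable).inner
    (continuous_gradient_of_contDiff
      (contDiff_gaussVortexProfile (n := 1))).stronglyMeasurable).aestronglyMeasurable

/-- `T_{λ,R} w` is a.e. strongly measurable for `w ∈ C²`. [folklore] -/
theorem parity_aestronglyMeasurable_coreOp (lam R : ℝ) {w : EuclideanSpace ℝ (Fin 2) → ℝ}
    (hw : ContDiff ℝ 2 w) :
    AEStronglyMeasurable (fun x => strainedVorticityOperator lam w x -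
      R * (⟪gaussVortexVelocity x, gradient w x⟫_ℝ +
        ⟪biotSavart2D w x, gradient gaussVortexProfile x⟫_ℝ)) volume := by
  refine ((parity_continuous_localPart lam R hw).aestronglyMeasurable.sub
    ((parity_aestronglyMeasurable_bsPart hw.continuous).const_mul R)).congr
    (Eventually.of_forall fun x => ?_)
  simp only [Pi.sub_apply]
  ring

/-- **`G_λ⁻¹ (T_{λ,R} w)² ∈ L¹`** for `C²` compactly supported `w`, `λ ∈ [0,1)`, every `R`: the
local part is continuous with compact support, the Biot–Savart part is bounded by `C‖∇G‖`.
[folklore] -/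
theorem parity_integrable_weight_mul_coreOp_sq {lam : ℝ} (hlam : lam ∈ Set.Ico (0 : ℝ) 1) (R : ℝ)
    {w : EuclideanSpace ℝ (Fin 2) → ℝ} (hw : ContDiff ℝ 2 w) (hwc : HasCompactSupport w) :
    Integrable fun x => (gaussWeightLam lam x)⁻¹ * (strainedVorticityOperator lam w x -
      R * (⟪gaussVortexVelocity x, gradient w x⟫_ℝ +
        ⟪biotSavart2D w x, gradient gaussVortexProfile x⟫_ℝ)) ^ 2 := by
  have hl1 : lam < 1 := hlam.2
  have h1l : 0 < 1 - lam := by linarith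
  have hgc : Continuous fun x => (gaussWeightLam lam x)⁻¹ := by
    refine Continuous.inv₀ ?_ fun x => (gaussWeightLam_pos hl1 x).ne'
    unfold gaussWeightLam
    exact continuous_const.mul (Real.continuous_exp.comp
      ((continuous_const.mul (continuous_norm.pow 2)).neg))
  have hg0 : ∀ x, 0 ≤ (gaussWeightLam lam x)⁻¹ := fun x => (inv_pos.2 (gaussWeightLam_pos hl1 x)).le
  -- local part `A`, Biot–Savart part `B`
  set A : EuclideanSpace ℝ (Fin 2) → ℝ := fun x =>
    strainedVorticityOperator lam w x - R * ⟪gaussVortexVelocity x, gradient w x⟫_ℝ with hA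
  set B : EuclideanSpace ℝ (Fin 2) → ℝ := fun x =>
    ⟪biotSavart2D w x, gradient gaussVortexProfile x⟫_ℝ with hB
  have hAc : Continuous A := parity_continuous_localPart lam R hw
  have hAi : Integrable fun x => (gaussWeightLam lam x)⁻¹ * A x ^ 2 :=
    (hgc.mul (hAc.pow 2)).integrable_of_hasCompactSupport
      (HasCompactSupport.intro hwc.isCompact fun x hx => by
        show (gaussWeightLam lam x)⁻¹ * A x ^ 2 = 0
        have h0 : A x = 0 := parity_localPart_eq_zero lam R hx
        rw [h0]
        simp)
  obtain ⟨C, hC⟩ := parity_exists_norm_biotSavart2D_le hw.continuous hwc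
  have hBm : AEStronglyMeasurable B volume := parity_aestronglyMeasurable_bsPart hw.continuous
  have hBle : ∀ x, (gaussWeightLam lam x)⁻¹ * B x ^ 2 ≤
      C ^ 2 * (4 / (1 - lam) * gaussWeightLam (1 / 2) x) := fun x => by
    have h2 : |B x| ≤ C * ‖gradient gaussVortexProfile x‖ :=
      (abs_real_inner_le_norm _ _).trans (mul_le_mul_of_nonneg_right (hC x) (norm_nonneg _))
    have h3 := pow_le_pow_left₀ (abs_nonneg _) h2 2
    rw [sq_abs, mul_pow] at h3
    calc (gaussWeightLam lam x)⁻¹ * B x ^ 2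
        ≤ (gaussWeightLam lam x)⁻¹ * (C ^ 2 * ‖gradient gaussVortexProfile x‖ ^ 2) :=
          mul_le_mul_of_nonneg_left h3 (hg0 x)
      _ = C ^ 2 * ((gaussWeightLam lam x)⁻¹ * ‖gradient gaussVortexProfile x‖ ^ 2) := by ring
      _ ≤ C ^ 2 * (4 / (1 - lam) * gaussWeightLam (1 / 2) x) :=
          mul_le_mul_of_nonneg_left (parity_inv_weight_mul_norm_gradient_sq_le hlam x) (sq_nonneg C)
  -- majorant
  have hGi : Integrable fun x => 2 * (R ^ 2 * (C ^ 2 * (4 / (1 - lam) * gaussWeightLam (1 / 2) x))) :=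
    ((((integrable_gaussWeightLam (by norm_num : (1 / 2 : ℝ) < 1)).const_mul (4 / (1 - lam))).const_mul
      (C ^ 2)).const_mul (R ^ 2)).const_mul 2
  have hmaj : Integrable fun x => 2 * ((gaussWeightLam lam x)⁻¹ * A x ^ 2) +
      2 * (R ^ 2 * (C ^ 2 * (4 / (1 - lam) * gaussWeightLam (1 / 2) x))) :=
    (hAi.const_mul 2).add hGi
  refine hmaj.mono' ?_ (Eventually.of_forall fun x => ?_)
  · have : AEStronglyMeasurable (fun x => (gaussWeightLam lam x)⁻¹ * (A x - R * B x) ^ 2) volume :=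
      (hgc.aestronglyMeasurable.aemeasurable.mul ((hAc.aestronglyMeasurable.aemeasurable.sub
        (hBm.aemeasurable.const_mul R)).pow_const 2)).aestronglyMeasurable
    refine this.congr (Eventually.of_forall fun x => ?_)
    simp only [hA, hB]
    ring
  · rw [Real.norm_eq_abs, abs_of_nonneg (mul_nonneg (hg0 x) (sq_nonneg _))]
    have hT : strainedVorticityOperator lam w x - R * (⟪gaussVortexVelocity x, gradient w x⟫_ℝ +
        ⟪biotSavart2D w x, gradient gaussVortexProfile x⟫_ℝ) = A x - R * B x := by
      simp only [hA, hB]; ring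
    rw [hT]
    have hsq : (A x - R * B x) ^ 2 ≤ 2 * A x ^ 2 + 2 * (R ^ 2 * B x ^ 2) := by
      nlinarith [sq_nonneg (A x + R * B x)]
    calc (gaussWeightLam lam x)⁻¹ * (A x - R * B x) ^ 2
        ≤ (gaussWeightLam lam x)⁻¹ * (2 * A x ^ 2 + 2 * (R ^ 2 * B x ^ 2)) :=
          mul_le_mul_of_nonneg_left hsq (hg0 x)
      _ = 2 * ((gaussWeightLam lam x)⁻¹ * A x ^ 2) +
            2 * (R ^ 2 * ((gaussWeightLam lam x)⁻¹ * B x ^ 2)) := by ring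
      _ ≤ 2 * ((gaussWeightLam lam x)⁻¹ * A x ^ 2) +
            2 * (R ^ 2 * (C ^ 2 * (4 / (1 - lam) * gaussWeightLam (1 / 2) x))) :=
          add_le_add_right (mul_le_mul_of_nonneg_left
            (mul_le_mul_of_nonneg_left (hBle x) (sq_nonneg R)) zero_le_two) _

/-! ### The registered stub -/

/-- **Stub 3 of crux stmt-NavierStokesRegularity-17973, line `Sketch` (parity bookkeeping).** For
`λ ∈ [0,1)`, `R ∈ ℝ` and a `C²` compactly supported vorticity `w`: the even/odd parts
`w_e = (w + w∘(−·))/2`, `w_o = (w − w∘(−·))/2` are `C²` with compact support, have the stated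
parities, `∫ w_e = ∫ w`, `∫ xᵢ w_o = ∫ xᵢ w`, and both `‖·‖²_{X_λ}` and `‖T_{λ,R}·‖²_{X_λ}` split
orthogonally: `‖w‖² = ‖w_e‖² + ‖w_o‖²`, `‖Tw‖² = ‖Tw_e‖² + ‖Tw_o‖²` (`T` commutes with `x ↦ −x`
and is linear; `G_λ` is even; `G_λ⁻¹(Tw)² ∈ L¹`). [folklore] -/
theorem stub_parityTools :
    ∀ lam ∈ Set.Ico (0 : ℝ) 1, ∀ (R : ℝ) (w : EuclideanSpace ℝ (Fin 2) → ℝ), ContDiff ℝ 2 w →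
    HasCompactSupport w →
    ContDiff ℝ 2 (fun x => (w x + w (-x)) / 2) ∧ HasCompactSupport (fun x => (w x + w (-x)) / 2) ∧
    ContDiff ℝ 2 (fun x => (w x - w (-x)) / 2) ∧ HasCompactSupport (fun x => (w x - w (-x)) / 2) ∧
    (∀ x : EuclideanSpace ℝ (Fin 2), (w (-x) + w (- -x)) / 2 = (w x + w (-x)) / 2) ∧
    (∀ x : EuclideanSpace ℝ (Fin 2), (w (-x) - w (- -x)) / 2 = -((w x - w (-x)) / 2)) ∧
    ∫ x, (w x + w (-x)) / 2 = ∫ x, w x ∧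
    ∫ x : EuclideanSpace ℝ (Fin 2), x 0 * ((w x - w (-x)) / 2) = ∫ x, x 0 * w x ∧
    ∫ x : EuclideanSpace ℝ (Fin 2), x 1 * ((w x - w (-x)) / 2) = ∫ x, x 1 * w x ∧
    ∫ x, (gaussWeightLam lam x)⁻¹ * w x ^ 2 =
      (∫ x, (gaussWeightLam lam x)⁻¹ * ((w x + w (-x)) / 2) ^ 2) +
        ∫ x, (gaussWeightLam lam x)⁻¹ * ((w x - w (-x)) / 2) ^ 2 ∧
    ∫ x, (gaussWeightLam lam x)⁻¹ * (strainedVorticityOperator lam w x -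
        R * (⟪gaussVortexVelocity x, gradient w x⟫_ℝ +
          ⟪biotSavart2D w x, gradient gaussVortexProfile x⟫_ℝ)) ^ 2 =
      (∫ x, (gaussWeightLam lam x)⁻¹ *
        (strainedVorticityOperator lam (fun y => (w y + w (-y)) / 2) x -
          R * (⟪gaussVortexVelocity x, gradient (fun y => (w y + w (-y)) / 2) x⟫_ℝ +
            ⟪biotSavart2D (fun y => (w y + w (-y)) / 2) x, gradient gaussVortexProfile x⟫_ℝ)) ^ 2) +
      ∫ x, (gaussWeightLam lam x)⁻¹ *
        (strainedVorticityOperator lam (fun y => (w y - w (-y)) / 2) x -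
          R * (⟪gaussVortexVelocity x, gradient (fun y => (w y - w (-y)) / 2) x⟫_ℝ +
            ⟪biotSavart2D (fun y => (w y - w (-y)) / 2) x, gradient gaussVortexProfile x⟫_ℝ)) ^ 2 := by
  intro lam hlam R w hw hwc
  have hl1 : lam < 1 := hlam.2
  have hwn : ContDiff ℝ 2 fun y => w (-y) := parity_contDiff_comp_neg hw
  have hwnc : HasCompactSupport fun y => w (-y) := parity_hasCompactSupport_comp_neg hwc
  have hK : IsCompact (tsupport w ∪ tsupport fun y => w (-y)) :=
    hwc.isCompact.union hwnc.isCompact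
  have hzero : ∀ x ∉ tsupport w ∪ tsupport (fun y => w (-y)), w x = 0 ∧ w (-x) = 0 :=
    fun x hx => by
    rw [Set.mem_union, not_or] at hx
    have h2 : (fun y => w (-y)) x = 0 := image_eq_zero_of_notMem_tsupport (f := fun y => w (-y)) hx.2
    exact ⟨image_eq_zero_of_notMem_tsupport hx.1, h2⟩
  -- the weight `G_λ⁻¹`: even, nonnegative, continuous
  have hgc : Continuous fun x => (gaussWeightLam lam x)⁻¹ := by
    refine Continuous.inv₀ ?_ fun x => (gaussWeightLam_pos hl1 x).ne'
    unfold gaussWeightLam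
    exact continuous_const.mul (Real.continuous_exp.comp
      ((continuous_const.mul (continuous_norm.pow 2)).neg))
  have hg0 : ∀ x, 0 ≤ (gaussWeightLam lam x)⁻¹ := fun x => (inv_pos.2 (gaussWeightLam_pos hl1 x)).le
  have hge : ∀ x, (gaussWeightLam lam (-x))⁻¹ = (gaussWeightLam lam x)⁻¹ := fun x => by
    simp [gaussWeightLam, norm_neg]
  -- integrability of `w`, moments
  have hwi : Integrable w := hw.continuous.integrable_of_hasCompactSupport hwc
  have hwni : Integrable fun x => w (-x) := hwi.comp_neg
  have hxw : ∀ i : Fin 2, Integrable fun x : EuclideanSpace ℝ (Fin 2) => x i * w x := fun i =>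
    ((PiLp.continuous_apply 2 _ i).mul hw.continuous).integrable_of_hasCompactSupport hwc.mul_left
  have hxwn : ∀ i : Fin 2, Integrable fun x : EuclideanSpace ℝ (Fin 2) => x i * w (-x) := fun i =>
    ((PiLp.continuous_apply 2 _ i).mul hwn.continuous).integrable_of_hasCompactSupport
      hwnc.mul_left
  have hmom : ∀ i : Fin 2, ∫ x : EuclideanSpace ℝ (Fin 2), x i * ((w x - w (-x)) / 2) =
      ∫ x : EuclideanSpace ℝ (Fin 2), x i * w x := fun i => by
    have h1 : ∫ x : EuclideanSpace ℝ (Fin 2), x i * w (-x) =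
        -∫ x : EuclideanSpace ℝ (Fin 2), x i * w x := by
      rw [← integral_neg_eq_self (fun x : EuclideanSpace ℝ (Fin 2) => x i * w x) volume,
        ← integral_neg]
      refine integral_congr_ae (Eventually.of_forall fun x => ?_)
      simp only [WithLp.ofLp_neg, Pi.neg_apply]
      ring
    have h2 : ∀ x : EuclideanSpace ℝ (Fin 2), x i * ((w x - w (-x)) / 2) =
        (x i * w x - x i * w (-x)) / 2 := fun x => by ring
    simp_rw [h2]
    rw [integral_div, integral_sub (hxw i) (hxwn i), h1]
    ring
  have hwX : Integrable fun x => (gaussWeightLam lam x)⁻¹ * w x ^ 2 :=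
    (hgc.mul (hw.continuous.pow 2)).integrable_of_hasCompactSupport
      (HasCompactSupport.intro hwc.isCompact fun x hx => by
        simp [image_eq_zero_of_notMem_tsupport hx])
  refine ⟨(hw.add hwn).div_const 2,
    HasCompactSupport.intro hK fun x hx => by simp [(hzero x hx).1, (hzero x hx).2],
    (hw.sub hwn).div_const 2,
    HasCompactSupport.intro hK fun x hx => by simp [(hzero x hx).1, (hzero x hx).2],
    fun x => by rw [neg_neg, add_comm], fun x => by rw [neg_neg]; ring, ?_, hmom 0, hmom 1,
    parity_integral_mul_sq_eq_add hge hg0 hgc hw.continuous.aestronglyMeasurable hwX, ?_⟩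
  · rw [integral_div, integral_add hwi hwni, integral_neg_eq_self w volume]
    ring
  · rw [parity_integral_mul_sq_eq_add hge hg0 hgc (parity_aestronglyMeasurable_coreOp lam R hw)
      (parity_integrable_weight_mul_coreOp_sq hlam R hw hwc)]
    congr 1
    · refine integral_congr_ae (Eventually.of_forall fun x => ?_)
      dsimp only
      rw [parity_coreOp_evenPart lam R hw hwc x]
    · refine integral_congr_ae (Eventually.of_forall fun x => ?_)
      dsimp only
      rw [parity_coreOp_oddPart lam R hw hwc x]

end Summit.NavierStokesRegularity.NavierStokesRegularity.Theorems
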